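import Mathlib
import Summits.PneNP.PneNP.Theorems.OverlapGapAlgebraSolvableImpliesStableSectionRepairClauseFibre
import Summits.PneNP.PneNP.Theorems.OverlapGapAlgebraSolvableImpliesStableSectionRerandomize
import Summits.PneNP.PneNP.Theorems.OverlapGapAlgebraSolvableImpliesStableSectionRepairProductCount

/-!
# Route OverlapGapAlgebra, crux `SolvableImpliesStableSection` (stmt-PneNP-2463), line `Sketch` v4:
# block "one round of local repair" — the mean bound and Chebyshev from the mean

Support lemmas for `stub_repairAssembly` (skeleton v4, file `…RepairAssembly.lean`):

* `ra_viol_imp_cond` — a clause violated by the repair map `g₁` (`g₁ Φ v := [v is the first variable of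
  an all-positive clause of Φ]`) has a negative literal, and every negative literal of it sits on the first
  variable of some OTHER all-positive clause;
* `ra_F_update` — that set of first variables does not depend on the clause itself;
* `ra_sum_indicator_le` — the MEAN BOUND per clause:
  `∑_Φ [clause i violated by g₁ Φ] ≤ 2^{-k} · #Inst · ((1 + 2^{-k}((1+1/n)^k - 1))^m - 1)`
  (re-randomise clause `i` by `stub_rerandomize`, count the fibre by `stub_repairClauseFibre`, and the
  other clauses by `stub_repairProductCount`);
* `ra_card_mul_sq_le` — Chebyshev from a mean bound, counting form.
No new definitions; axioms `propext`, `Classical.choice`, `Quot.sound`.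
-/

set_option linter.dupNamespace false

namespace Summit.PneNP.PneNP.Cruxes.SolvableImpliesStableSection.Sketch

open Finset
open scoped Classical

/-- A clause violated by the repair map has a negative literal, and every negative literal of it sits on
the first variable of some OTHER all-positive clause. -/
theorem ra_viol_imp_cond {k m n : ℕ} (hk : 0 < k) (g : (Fin m → Fin k → Fin n × Bool) → (Fin n → Bool))
    (hg : ∀ (Φ : Fin m → Fin k → Fin n × Bool) (v : Fin n),
      g Φ v = true ↔ ∃ a : Fin m, (Φ a ⟨0, hk⟩).1 = v ∧ ∀ j, (Φ a j).2 = true)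
    (Φ : Fin m → Fin k → Fin n × Bool) (i : Fin m) (hviol : ∀ j, g Φ (Φ i j).1 ≠ (Φ i j).2) :
    (∃ j, (Φ i j).2 = false) ∧ ∀ j, (Φ i j).2 = false → (Φ i j).1 ∈
      ((univ : Finset (Fin m)).filter fun a => a ≠ i ∧ ∀ j, (Φ a j).2 = true).image
        fun a => (Φ a ⟨0, hk⟩).1 := by
  have hnot : ¬ ∀ j, (Φ i j).2 = true := by
    intro hall
    have h1 : g Φ (Φ i ⟨0, hk⟩).1 = true := (hg Φ _).2 ⟨i, rfl, hall⟩
    exact hviol ⟨0, hk⟩ (by rw [h1, hall])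
  refine ⟨?_, fun j hj => ?_⟩
  · push Not at hnot
    obtain ⟨j, hj⟩ := hnot
    exact ⟨j, by simpa using hj⟩
  · have h1 : g Φ (Φ i j).1 = true := by
      have := hviol j
      rw [hj] at this
      simpa using this
    obtain ⟨a, ha, hall⟩ := (hg Φ _).1 h1
    have hai : a ≠ i := by
      rintro rfl
      exact hnot hall
    exact Finset.mem_image.2 ⟨a, Finset.mem_filter.2 ⟨Finset.mem_univ _, hai, hall⟩, ha⟩

/-- The set of first variables of the other all-positive clauses does not depend on clause `i`. -/
theorem ra_F_update {k m n : ℕ} (hk : 0 < k) (i : Fin m) (Φ : Fin m → Fin k → Fin n × Bool)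
    (c : Fin k → Fin n × Bool) :
    (((univ : Finset (Fin m)).filter fun a =>
        a ≠ i ∧ ∀ j, ((Function.update Φ i c) a j).2 = true).image
          fun a => ((Function.update Φ i c) a ⟨0, hk⟩).1)
      = ((univ : Finset (Fin m)).filter fun a => a ≠ i ∧ ∀ j, (Φ a j).2 = true).image
          fun a => (Φ a ⟨0, hk⟩).1 := by
  ext v
  simp only [Finset.mem_image, Finset.mem_filter, Finset.mem_univ, true_and]
  constructor
  · rintro ⟨a, ⟨hai, hall⟩, hav⟩
    rw [Function.update_of_ne hai] at hall hav
    exact ⟨a, ⟨hai, hall⟩, hav⟩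
  · rintro ⟨a, ⟨hai, hall⟩, hav⟩
    refine ⟨a, ⟨hai, ?_⟩, ?_⟩
    · rw [Function.update_of_ne hai]; exact hall
    · rw [Function.update_of_ne hai]; exact hav

/-- **Mean bound, one clause.** Summed over all instances, the indicator that clause `i` is violated by
the repair map is at most `2^{-k} · #Inst · ((1 + 2^{-k}((1+1/n)^k - 1))^m - 1)`. -/
theorem ra_sum_indicator_le (k m n : ℕ) (hk : 0 < k) (hn : 1 ≤ n)
    (g : (Fin m → Fin k → Fin n × Bool) → (Fin n → Bool))
    (hg : ∀ (Φ : Fin m → Fin k → Fin n × Bool) (v : Fin n),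
      g Φ v = true ↔ ∃ a : Fin m, (Φ a ⟨0, hk⟩).1 = v ∧ ∀ j, (Φ a j).2 = true)
    (i : Fin m) :
    ∑ Φ : Fin m → Fin k → Fin n × Bool, (if ∀ j, g Φ (Φ i j).1 ≠ (Φ i j).2 then (1 : ℝ) else 0)
      ≤ (1 / 2 : ℝ) ^ k * Fintype.card (Fin m → Fin k → Fin n × Bool) *
          ((1 + (1 / 2 : ℝ) ^ k * ((1 + 1 / (n : ℝ)) ^ k - 1)) ^ m - 1) := by
  -- the statistic of the other clauses and the clause functional
  set F : (Fin m → Fin k → Fin n × Bool) → Finset (Fin n) := fun Φ =>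
    ((univ : Finset (Fin m)).filter fun a => a ≠ i ∧ ∀ j, (Φ a j).2 = true).image
      fun a => (Φ a ⟨0, hk⟩).1 with hF
  set h : (Fin k → Fin n × Bool) → Finset (Fin n) → ℝ := fun c S =>
    if (∃ j, (c j).2 = false) ∧ ∀ j, (c j).2 = false → (c j).1 ∈ S then 1 else 0 with hh
  have hFupd : ∀ (Φ : Fin m → Fin k → Fin n × Bool) (c : Fin k → Fin n × Bool),
      F (Function.update Φ i c) = F Φ := fun Φ c => ra_F_update hk i Φ c
  -- pointwise domination of the violation indicator
  have hdom : ∀ Φ : Fin m → Fin k → Fin n × Bool,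
      (if ∀ j, g Φ (Φ i j).1 ≠ (Φ i j).2 then (1 : ℝ) else 0) ≤ h (Φ i) (F Φ) := by
    intro Φ
    by_cases hv : ∀ j, g Φ (Φ i j).1 ≠ (Φ i j).2
    · have hc := ra_viol_imp_cond hk g hg Φ i hv
      rw [if_pos hv, hh]
      simp only
      rw [if_pos hc]
    · rw [if_neg hv, hh]
      simp only
      split_ifs <;> norm_num
  -- re-randomise clause `i`
  have hre := stub_rerandomize (C := Fin k → Fin n × Bool) i F hFupd h
  -- the fibre count and the product count
  have hfib : ∀ Φ : Fin m → Fin k → Fin n × Bool, ∑ c : Fin k → Fin n × Bool, h c (F Φ)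
      ≤ ((n : ℝ) + ((univ : Finset (Fin m)).filter fun a =>
            a ≠ i ∧ ∀ j, (Φ a j).2 = true).card) ^ k - (n : ℝ) ^ k := by
    intro Φ
    have h1 : ∑ c : Fin k → Fin n × Bool, h c (F Φ) =
        (((univ : Finset (Fin k → Fin n × Bool)).filter fun c =>
          (∃ j, (c j).2 = false) ∧ ∀ j, (c j).2 = false → (c j).1 ∈ F Φ).card : ℝ) := by
      rw [hh, Finset.natCast_card_filter]
    have h2 := stub_repairClauseFibre k n (F Φ)
    have h3 : ((F Φ).card : ℝ) ≤ ((univ : Finset (Fin m)).filter fun a =>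
        a ≠ i ∧ ∀ j, (Φ a j).2 = true).card := by
      rw [hF]
      exact_mod_cast Finset.card_image_le
    have h4 : ((n : ℝ) + (F Φ).card) ^ k ≤ ((n : ℝ) + ((univ : Finset (Fin m)).filter fun a =>
        a ≠ i ∧ ∀ j, (Φ a j).2 = true).card) ^ k :=
      pow_le_pow_left₀ (by positivity) (by linarith) k
    rw [h1]
    linarith
  have hprod := stub_repairProductCount k m n hn i
  have hC : (Fintype.card (Fin k → Fin n × Bool) : ℝ) = (2 * n : ℝ) ^ k := by
    rw [Fintype.card_fun, Fintype.card_prod, Fintype.card_fin, Fintype.card_bool, Fintype.card_fin]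
    push_cast
    ring
  have hnpos : (0 : ℝ) < n := by exact_mod_cast hn
  have h2n : (0 : ℝ) < (2 * n : ℝ) ^ k := by positivity
  -- combine
  have hsum : (2 * n : ℝ) ^ k * ∑ Φ : Fin m → Fin k → Fin n × Bool,
      (if ∀ j, g Φ (Φ i j).1 ≠ (Φ i j).2 then (1 : ℝ) else 0)
      ≤ (n : ℝ) ^ k * Fintype.card (Fin m → Fin k → Fin n × Bool) *
          ((1 + (1 / 2 : ℝ) ^ k * ((1 + 1 / (n : ℝ)) ^ k - 1)) ^ m - 1) := by
    calc (2 * n : ℝ) ^ k * ∑ Φ : Fin m → Fin k → Fin n × Bool,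
          (if ∀ j, g Φ (Φ i j).1 ≠ (Φ i j).2 then (1 : ℝ) else 0)
        ≤ (2 * n : ℝ) ^ k * ∑ Φ : Fin m → Fin k → Fin n × Bool, h (Φ i) (F Φ) :=
          mul_le_mul_of_nonneg_left (Finset.sum_le_sum fun Φ _ => hdom Φ) h2n.le
      _ = ∑ Φ : Fin m → Fin k → Fin n × Bool, ∑ c : Fin k → Fin n × Bool, h c (F Φ) := by
          rw [← hC, hre]
      _ ≤ ∑ Φ : Fin m → Fin k → Fin n × Bool,
            (((n : ℝ) + ((univ : Finset (Fin m)).filter fun a =>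
              a ≠ i ∧ ∀ j, (Φ a j).2 = true).card) ^ k - (n : ℝ) ^ k) :=
          Finset.sum_le_sum fun Φ _ => hfib Φ
      _ ≤ _ := hprod
  have hhalf : (n : ℝ) ^ k / (2 * n : ℝ) ^ k = (1 / 2 : ℝ) ^ k := by
    rw [← div_pow]; congr 1; field_simp
  calc ∑ Φ : Fin m → Fin k → Fin n × Bool, (if ∀ j, g Φ (Φ i j).1 ≠ (Φ i j).2 then (1 : ℝ) else 0)
      = ((2 * n : ℝ) ^ k * ∑ Φ : Fin m → Fin k → Fin n × Bool,
          (if ∀ j, g Φ (Φ i j).1 ≠ (Φ i j).2 then (1 : ℝ) else 0)) / (2 * n : ℝ) ^ k := by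
        field_simp
    _ ≤ ((n : ℝ) ^ k * Fintype.card (Fin m → Fin k → Fin n × Bool) *
          ((1 + (1 / 2 : ℝ) ^ k * ((1 + 1 / (n : ℝ)) ^ k - 1)) ^ m - 1)) / (2 * n : ℝ) ^ k :=
        div_le_div_of_nonneg_right hsum h2n.le
    _ = ((n : ℝ) ^ k / (2 * n : ℝ) ^ k) * Fintype.card (Fin m → Fin k → Fin n × Bool) *
          ((1 + (1 / 2 : ℝ) ^ k * ((1 + 1 / (n : ℝ)) ^ k - 1)) ^ m - 1) := by ring
    _ = _ := by rw [hhalf]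

/-- **Chebyshev from the mean (counting form).** If `∑ V ≤ μ₀ · N` and `∑ (V - mean)² ≤ W`, then every set
on which `V > μ₀ + t` (`t > 0`) has at most `W / t²` elements: `#S · t² ≤ W`. -/
theorem ra_card_mul_sq_le {ι : Type*} [Fintype ι] (V : ι → ℝ) (W μ₀ t : ℝ) (ht : 0 < t)
    (hmean : ∑ x, V x ≤ μ₀ * Fintype.card ι)
    (hW : ∑ x, (V x - (∑ y, V y) / Fintype.card ι) ^ 2 ≤ W)
    (S : Finset ι) (hS : ∀ x ∈ S, μ₀ + t < V x) :
    (S.card : ℝ) * t ^ 2 ≤ W := by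
  rcases S.eq_empty_or_nonempty with hS0 | hSne
  · rw [hS0, Finset.card_empty, Nat.cast_zero, zero_mul]
    exact le_trans (Finset.sum_nonneg fun x _ => sq_nonneg _) hW
  obtain ⟨x0, hx0⟩ := hSne
  have hN : (0 : ℝ) < Fintype.card ι := by
    have : Nonempty ι := ⟨x0⟩
    exact_mod_cast Fintype.card_pos
  set μ : ℝ := (∑ y, V y) / Fintype.card ι with hμ
  have hμle : μ ≤ μ₀ := by
    rw [hμ, div_le_iff₀ hN]; exact hmean
  have hpt : ∀ x ∈ S, t ^ 2 ≤ (V x - μ) ^ 2 := by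
    intro x hx
    have h1 : t ≤ V x - μ := by linarith [hS x hx]
    exact pow_le_pow_left₀ ht.le h1 2
  calc (S.card : ℝ) * t ^ 2 = ∑ x ∈ S, t ^ 2 := by rw [Finset.sum_const, nsmul_eq_mul]
    _ ≤ ∑ x ∈ S, (V x - μ) ^ 2 := Finset.sum_le_sum hpt
    _ ≤ ∑ x, (V x - μ) ^ 2 :=
        Finset.sum_le_sum_of_subset_of_nonneg (Finset.subset_univ S) fun x _ _ => sq_nonneg _
    _ ≤ W := hW


end Summit.PneNP.PneNP.Cruxes.SolvableImpliesStableSection.Sketch
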